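import Summits.Langlands.Langlands.Theses.EisensteinGelfandKirillov
import Literature.NumberTheory.GaloisRepresentations.OddAbsolutelyIrreducibleProofs

/-!
# Stub `stub_absolutelyIrreducible_of_odd` for the crux `CrystallineProModularClassical` (line `Sketch`)

Glue for the exit crux `Summit.Langlands.Langlands.Theses.EisensteinGelfandKirillov.CrystallineProModularClassical`
(stmt-Langlands-18274): an odd, irreducible, two-dimensional `p`-adic representation
`ρ : Γ_F → GL₂(ℚ̄_p)` of a totally real number field `F` is absolutely irreducible.  This is the
remark of Darmon–Diamond–Taylor, *Fermat's Last Theorem* (1995), Thm. 3.1 (b)–(c) and p. 87, valid in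
any characteristic `≠ 2`; in the tree it is the theorem
`Literature.NumberTheory.GaloisRepresentations.FramedGaloisRep.IsOdd.isAbsolutelyIrreducible`, which
asks for a real embedding `φ : F →+* ℝ` (to produce a complex conjugation) and `(2 : A) ≠ 0`.

Here we only supply those two inputs: a totally real number field has an infinite place
(`NumberField.InfinitePlace F` is nonempty since `F →+* ℂ` is), every infinite place is real
(`NumberField.IsTotallyReal.isReal`), and a real place gives a real embedding
(`NumberField.InfinitePlace.embedding_of_isReal`); and `ℚ̄_p = PadicAlgCl p` has characteristic
zero, so `2 ≠ 0`.  The hypothesis `ρ.toGaloisRep.IsIrreducible` is definitionally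
`FramedRep.IsIrreducible ρ` (`FramedRep.isIrreducible_toContinuousRep_iff`, `Iff.rfl`).

No new definitions, no named facts; sorry-free.
-/

set_option linter.dupNamespace false -- `Summit.Langlands.Langlands` is the mandated namespace (D-0017)

open Literature.NumberTheory.GaloisRepresentations NumberField

namespace Summit.Langlands.Langlands.Theorems.CrystallineProModularClassical

/-- **Odd irreducible two-dimensional `p`-adic Galois representations of a totally real field are
absolutely irreducible.**  For `F` a totally real number field, `p` a prime and
`ρ : Γ_F → GL₂(ℚ̄_p)` (`FramedGaloisRep F (PadicAlgCl p) 2`) which is irreducible over `ℚ̄_p`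
(`ρ.toGaloisRep.IsIrreducible`) and odd (`ρ.IsOdd`: `det ρ(c) = -1` for every complex conjugation
`c`), `ρ` is absolutely irreducible (`FramedRep.IsAbsolutelyIrreducible`: irreducible after every
base change to a field).  Proof: pick an infinite place `w` of `F`; it is real since `F` is totally
real, so `F` has a real embedding `φ = embedding_of_isReal`; `(2 : ℚ̄_p) ≠ 0` by characteristic zero;
conclude by `FramedGaloisRep.IsOdd.isAbsolutelyIrreducible φ` (Darmon–Diamond–Taylor 1995,
Thm. 3.1 (b)–(c) and p. 87: "if `ℓ` is odd, one checks using (b) that `ρ̄` is irreducible if and only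
if it is absolutely irreducible").
[cite: DarmonDiamondTaylor1995, Thm. 3.1 (b)–(c) and p. 87] -/
theorem stub_absolutelyIrreducible_of_odd : ∀ (F : Type) [Field F] [NumberField F], NumberField.IsTotallyReal F → ∀ (p : ℕ) [Fact p.Prime] (ρ : Literature.NumberTheory.GaloisRepresentations.FramedGaloisRep F (PadicAlgCl p) 2), ρ.toGaloisRep.IsIrreducible → ρ.IsOdd → Literature.NumberTheory.GaloisRepresentations.FramedRep.IsAbsolutelyIrreducible ρ := by
  intro F _ _ hF p _ ρ hirr hodd
  -- a real embedding of the totally real number field `F`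
  obtain ⟨w⟩ : Nonempty (NumberField.InfinitePlace F) := inferInstance
  have hw : w.IsReal := hF.isReal w
  -- `2 ≠ 0` in `ℚ̄_p` (characteristic zero)
  have h2 : (2 : PadicAlgCl p) ≠ 0 := two_ne_zero
  exact FramedGaloisRep.IsOdd.isAbsolutelyIrreducible (NumberField.InfinitePlace.embedding_of_isReal hw)
    hodd ((FramedRep.isIrreducible_toContinuousRep_iff ρ).mp hirr) h2

end Summit.Langlands.Langlands.Theorems.CrystallineProModularClassical
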